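import Mathlib
import HarnessLib
import Summits.NavierStokesRegularity.NavierStokesRegularity.Theorems.UnthreadedDoorNetFluxDefs
import Summits.NavierStokesRegularity.NavierStokesRegularity.Theorems.UnthreadedDoorNetFluxDenseFiniteZeroScalarLiouville

/-!
# Route `UnthreadedDoor`, crux `PoloidalLiouville` (stmt-NavierStokesRegularity-1222), WALL W1 — second-stratum line «height-head»
# (ns-idea-14 g5, `Cruxes/PoloidalLiouville/Lines/height_head.lean` v3): **THE K3ᴰ RUNG `DenseMorseScalarLiouvilleTypeI`, PROVED** (by name)

`NetFlux.denseMorseScalarLiouvilleTypeI_holds : <body of HeightHead.DenseMorseScalarLiouvilleTypeI (line v3 l.406–417) VERBATIM, with the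
line-local predicates IsMorseRadius / sphCrit / IsNondegSphereCrit unfolded to their bodies (precedent p679110)>`: the Type-I scalar Liouville
statement on the DENSE-MORSE stratum — a bounded ancient mild solution with Type-I time decay, smooth on the past slab, with toroidal-exact
vorticity `curl v = ∇T × (x − x₀)` (`T` bounded, smooth off `x₀`), obeying the curled potential law (E1) on `Iio 0`, such that at every `t < 0`
the «Morse radii» (spheres `S_r(x₀)` carrying finitely many, non-degenerate vorticity zeros) are dense in `(0, ∞)`, has `∇T × (x − x₀) ≡ 0`.

PROOF = the line's kernel corollary `denseMorse_of_denseFinite` run Theorems-side: a Morse radius is in particular a finite-zero radius, so the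
dense-Morse hypothesis implies the dense-finite-zero hypothesis (`closure_mono`), and the K3ᶠ rung
`NetFlux.denseFiniteZeroScalarLiouvilleTypeI_holds` (`…Theorems.UnthreadedDoorNetFluxDenseFiniteZeroScalarLiouville`, ARM A g5 — the Theorems-side
composition of HH-0 p682567 · HH-1/K1⁺ p679110 · HH-2/K2 p680049 · HH-3/4/5 p678532/p678535/p678536 · HH-6a p682734 · HH-6b p683221) concludes.
In the line: `theorem denseMorse_twin : DenseMorseScalarLiouvilleTypeI := Theorems.PoloidalLiouville.NetFlux.denseMorseScalarLiouvilleTypeI_holds`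
(`Iff.rfl` twin, checked on a scratch copy of line v3).

HONEST LABEL (KEY-NS #180, critic contract ns-wall-crit-1 g3 00:58:53Z): a THEOREM RUNG BELOW WALL W1 (partial stratum: dense-Morse ⊂
dense-finite-zero), containing the unimodal rung p675773; it is NOT the wall — crux `PoloidalLiouville` (1222) still needs the typed residual
(`NullSheetResidualTypeI` / `MultiHillScalarLiouvilleTypeI`); C⁻, W1 and the summit stay OPEN; NO Navier–Stokes regularity statement is proved.
`--supports stmt-NavierStokesRegularity-1222 --as helper`.  [folklore]
-/

noncomputable section

-- the summit and its single sub-problem share the name (CONVENTIONS §1)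
set_option linter.dupNamespace false

open Set Function Filter Topology MeasureTheory
open scoped RealInnerProductSpace

namespace Summit.NavierStokesRegularity.NavierStokesRegularity.Theorems.PoloidalLiouville.NetFlux

open Literature.Analysis Literature.Analysis.FluidPDE

/-- **K3ᴰ rung `DenseMorseScalarLiouvilleTypeI` (crux idea «height-head», ns-idea-14), PROVED**: Type-I scalar Liouville on the stratum
«at every `t < 0` the Morse radii are dense» — statement = the line's `HeightHead.DenseMorseScalarLiouvilleTypeI` verbatim with
`IsMorseRadius`/`sphCrit`/`IsNondegSphereCrit` unfolded.  Corollary of the K3ᶠ rung `denseFiniteZeroScalarLiouvilleTypeI_holds` (a Morse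
radius is a finite-zero radius).  A partial-stratum rung below W1; crux 1222 OPEN; no NS regularity statement is proved. [folklore] -/
theorem denseMorseScalarLiouvilleTypeI_holds :
    ∀ (v : ℝ → E3 → E3) (x₀ : E3) (T : ℝ → E3 → ℝ),
    (∃ C : ℝ, HasTypeITimeDecay C v) →
    IsBoundedAncientMildSolution 1 v →
    (∀ t < 0, AEStronglyMeasurable (v t) volume) →
    ContDiffOn ℝ (⊤ : ℕ∞) (uncurry v) (Iio 0 ×ˢ univ) →
    ContDiffOn ℝ (⊤ : ℕ∞) (uncurry T) (Iio 0 ×ˢ ({x₀}ᶜ : Set E3)) →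
    (∃ C : ℝ, ∀ t < 0, ∀ x, |T t x| ≤ C) →
    (∀ t < 0, ∀ x, curl (v t) x = cross (gradient (T t) x) (x - x₀)) →
    CurledLaw v x₀ T (Iio 0) →
    (∀ t < 0, Ioi (0 : ℝ) ⊆ closure {r : ℝ | 0 < r ∧
        {x : E3 | x ∈ Metric.sphere x₀ r ∧ cross (gradient (T t) x) (x - x₀) = 0}.Finite ∧
        ∀ x ∈ {x : E3 | x ∈ Metric.sphere x₀ r ∧ cross (gradient (T t) x) (x - x₀) = 0},
          ∀ u : E3, u ≠ 0 → ⟪u, x - x₀⟫ = 0 →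
            ∃ w : E3, ⟪w, x - x₀⟫ = 0 ∧
              iteratedFDeriv ℝ 2 (T t) x ![u, w] - (⟪gradient (T t) x, x - x₀⟫ / ‖x - x₀‖ ^ 2) * ⟪u, w⟫ ≠ 0}) →
    ∀ t < 0, ∀ x, cross (gradient (T t) x) (x - x₀) = 0 :=
  fun v x₀ T hC hB hm hsv hsT hTb hrep hE hM =>
    denseFiniteZeroScalarLiouvilleTypeI_holds v x₀ T hC hB hm hsv hsT hTb hrep hE
      (fun t ht => (hM t ht).trans (closure_mono fun _ hr => ⟨hr.1, hr.2.1⟩))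

end Summit.NavierStokesRegularity.NavierStokesRegularity.Theorems.PoloidalLiouville.NetFlux

end
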